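/-
Origin: expansion seat `planner-pub-hodgecm-pv01-g4-0`, handover #2 2026-08-18T06:35:38Z (`HOME/pub-hodgecm-pv01-g4/lean/Pv01g4/EndStateCensus.lean`, md5 41200b8e, 243 lines);
landed by the gen-7 packager in gate run 25 as `HodgeCM/PerL34/EndStateCensus.lean` (import ^import Pv[0-9]+g[0-9]+\.→import HodgeCM.PerL34. ×1).
-/
/-
Origin: planner-pub-hodgecm-pv01-g4-0 (unit pub-hodgecm-pv01-g4, DAG-NODE PROVER #01 gen 4; lineage pv01 → pv01-g2 →
pv01-g3), 2026-08-18.  Proposed tree path: `HodgeCM/PerL34/EndStateCensus.lean` (new, additive; fresh namespace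
`HodgeCM.PerL34.EndStateCensus`).  Imports this seat's `Pv01g4.EndStateStrength` (handover #1; rename to
`HodgeCM.PerL34.EndStateStrength`) and LANDED / run-24-STAGED tree modules.
KERNEL: nothing cited, nothing asserted — three `Prop`-valued records packaging binders that the tree's end-state
theorems already carry, and the implications / equivalences between them, each a one-line call of a landed or
staged strength theorem (S1: `EndStateStrength`, this seat; S4: `S4Strength`, pv12-g4; S5: `S5Conservative` /
`S5ConservativeQaut`, pv08-g3; S6: `S6Strength`, pv04-g4).
-/
import Summits.HodgeConjecture.HodgeCM.PerL34.EndStateStrength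
import Summits.HodgeConjecture.HodgeCM.PerL34.S6Strength
import Summits.HodgeConjecture.HodgeCM.PerL34.S5Conservative
import Summits.HodgeConjecture.HodgeCM.PerL34.S5ConservativeQaut_2
import Summits.HodgeConjecture.HodgeCM.PerL34.S4Strength_2
import Summits.HodgeConjecture.HodgeCM.PerL34.AssemblyNoLandherr

/-!
# End-state census in kernel form: headline record bundle ↔ dictionary leaves → node leaves → PerL

Referee A, round 17, G2 / P3 asks for the table of end-state forms and "which is load-bearing".  The tree answers
it binder by binder in four strength files; this file states the answer ONCE, as theorems about three records:

* `NodeLeaves T` — the six PerL-internal OPEN node leaves of the carver's DAG in their record-free form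
  (N12a `Open_thetaSub`, N19w `Open_thetaGen12`, N19g `Open_thetaReal34`, N29 `Open_occ`, N31 `Open_chars`,
  N33 `Open_thetaWedge`); `perL_of_nodeLeaves` = `perL_of_nodes''` (THE FLOOR: PerL from `M`, the print / design
  leaves N07 N09a N09b N12b, and these six);
* `HeadlineBundle T Pc` — the seven `T`-dependent, non-print binders of the headline
  `AssemblyRoutes.perL_of_openCharsWeilLeavesCRΔ` (`hAlb hbr hQ A12 A34 hch hW`); `perL_of_headlineBundle` = the
  headline;
* `DictLeaves T Pc` — what those seven binders are EXACTLY worth, componentwise: N12a (S6: `thetaAlbanese_iff_open`),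
  the (12) generator identity `N19w_genIdentity` (S5: `bridges_iff_genIdentity`), the (34) core `N19g_core`
  (S5: `qautBridges_iff_core`), the `D`-free archimedean charts with occurrence on each torus side
  (S4: `archC_binder_iff_core`), N31, and — by this seat's `EndStateStrength` — A6 `Open_thetaWedge` ∧ `ThetaMeet`
  for the S1 binder.

Theorems: `dictLeaves_of_headlineBundle` (↓, needs `M`, `Fact_cmInflation`), `headlineBundle_of_dictLeaves`
(↑, needs `M`, N07, N09a, N09b, the `T`-free `SplitHolConfig`, `Fact_coverTheta`), `headlineBundle_iff_dictLeaves`,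
`nodeLeaves_of_dictLeaves` (hypothesis-free), and the factorisation `perL_of_headlineBundle_eq` (the headline's
PerL IS the floor's PerL — trivially, `U.PerL` being a `Prop` — recorded as the statement that the headline factors
through `perL_of_nodes''`).  WHAT IS LOAD-BEARING: every field of `NodeLeaves` is a PerL-internal open input
(LEMMAS.md §2); the records of `HeadlineBundle` add, beyond the node leaves, exactly the dictionary-level
strengthenings `genIdentity ⇒ gen12`, `core34 ⇒ real34`, `charts ⇒ occ` (strict, see `S4Strength` /
`S5Conservative` module docstrings) and the 0-type `ThetaMeet`; none of them is a cited fact.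
-/

set_option autoImplicit false

noncomputable section

namespace HodgeCM
namespace PerL34
namespace EndStateCensus

open HodgeCM.Prior.Perl34File HodgeCM.Prior.Perl34File.Perl34 HodgeCM.PerL34.ArchC
open HodgeCM.PerL34.EndStateStrength HodgeCM.PerL34.CharSpansFinal HodgeCM.PerL34.S1StrengthCR

variable {U : Universe} (T : U.ThetaModel)

/-! ## 1. The three records -/

/-- The six PerL-internal open NODE leaves (record-free end state). -/
structure NodeLeaves : Prop where
  /-- N12a, PerL Lemma 3.3(a): theta one-forms are `B_{Ψ_i}`-isotypic `σ`-eigen holomorphic -/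
  thetaSub : T.Open_thetaSub
  /-- N19w, PerL Lemma 3.5 (12): `Λ ω₁ ω₂ ∈ S₁₂` -/
  gen12 : T.Open_thetaGen12
  /-- N19g, PerL Lemma 3.5 (34), closure form -/
  real34 : T.Open_thetaReal34
  /-- N29, PerL Lemma 4.1(c): occurrence -/
  occ : T.Open_occ
  /-- N31, PerL Lemma 4.2(b): all characters allowed -/
  chars : T.Open_chars
  /-- N33, PerL Prop 4.3: A6, a non-zero theta wedge -/
  wedge : T.Open_thetaWedge

/-- The seven `T`-dependent non-print binders of the headline `AssemblyRoutes.perL_of_openCharsWeilLeavesCRΔ`. -/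
structure HeadlineBundle
    (Pc : ∀ {L : CMField} {ι₁ : L →+* ℂ} (V : HermSpace3 L ι₁) (c : SeesawCtx L),
      C4a.PointedCore (T.core V c)) : Prop where
  /-- `hAlb` (S6) -/
  alb : T.Fact_thetaAlbanese
  /-- `hbr` (S5, side (12)) -/
  bridges : ∀ {L : CMField} {ι₁ : L →+* ℂ} (V : HermSpace3 L ι₁) (c : SeesawCtx L), T.GoodCtx ι₁ c →
    Nonempty (SeesawDictionary.SeesawBridge T V c (T.t12 V c) 0 1)
  /-- `hQ` (S5, side (34)) -/
  qaut : ∀ {L : CMField} {ι₁ : L →+* ℂ} (V : HermSpace3 L ι₁) (c : SeesawCtx L), T.GoodCtx ι₁ c →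
    Nonempty (QautDictionary.QautBridge T V c (T.t34 V c) 2 3)
  /-- `A12` (S4) -/
  arch12 : ∀ {L : CMField} {ι₁ : L →+* ℂ} (V : HermSpace3 L ι₁) (c : SeesawCtx L), T.GoodCtx ι₁ c →
    Nonempty (ArchCDatum (T.core V c) (T.t12 V c) (Pc V c))
  /-- `A34` (S4) -/
  arch34 : ∀ {L : CMField} {ι₁ : L →+* ℂ} (V : HermSpace3 L ι₁) (c : SeesawCtx L), T.GoodCtx ι₁ c →
    Nonempty (ArchCDatum (T.core V c) (T.t34 V c) (Pc V c))
  /-- `hch` (S3, record-free since run 23) -/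
  chars : T.Open_chars
  /-- `hW` (S1/S2, final form) -/
  weil : WeilStepsInputCRΔ T

/-- The DICTIONARY leaves: the exact worth of the seven binders, componentwise. -/
structure DictLeaves
    (Pc : ∀ {L : CMField} {ι₁ : L →+* ℂ} (V : HermSpace3 L ι₁) (c : SeesawCtx L),
      C4a.PointedCore (T.core V c)) : Prop where
  /-- = `alb` (S6: `thetaAlbanese_iff_open`) -/
  thetaSub : T.Open_thetaSub
  /-- = `bridges` (S5: `bridges_iff_genIdentity`) -/
  genIdentity : ∀ {L : CMField} {ι₁ : L →+* ℂ} (V : HermSpace3 L ι₁) (c : SeesawCtx L), T.GoodCtx ι₁ c →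
    N19w_genIdentity T V c (T.t12 V c) 0 1
  /-- = `qaut` (S5: `qautBridges_iff_core`) -/
  core34 : ∀ {L : CMField} {ι₁ : L →+* ℂ} (V : HermSpace3 L ι₁) (c : SeesawCtx L), T.GoodCtx ι₁ c →
    N19g_core T V c (T.t34 V c) 2 3
  /-- = `arch12` (S4: `archC_binder_iff_core`) -/
  charts12 : ∀ {L : CMField} {ι₁ : L →+* ℂ} (V : HermSpace3 L ι₁) (c : SeesawCtx L), T.GoodCtx ι₁ c →
    ∃ K : ArchCCore (T.core V c) (Pc V c), ∀ i, K.Eigen i → (T.t12 V c).wOccurs i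
  /-- = `arch34` -/
  charts34 : ∀ {L : CMField} {ι₁ : L →+* ℂ} (V : HermSpace3 L ι₁) (c : SeesawCtx L), T.GoodCtx ι₁ c →
    ∃ K : ArchCCore (T.core V c) (Pc V c), ∀ i, K.Eigen i → (T.t34 V c).wOccurs i
  /-- = `chars` -/
  chars : T.Open_chars
  /-- `wedge ∧ meet` = `weil` (S1: `EndStateStrength.weilStepsInputCRΔ_iff_thetaWedge`) -/
  wedge : T.Open_thetaWedge
  meet : ThetaMeet T

/-! ## 2. The floor and the headline -/

/-- **THE FLOOR**: PerL from `M`, the print / design leaves and the six node leaves (= `perL_of_nodes''`). -/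
theorem perL_of_nodeLeaves (M : U.ModelAxioms) (T : U.ThetaModel) (h07 : N07_hodgeRiemann20 U)
    (h09a : N09a_embCover T) (h09b : N09b_innerEmb T) (h12b : N12b_signRecipe T) (h : NodeLeaves T) : U.PerL :=
  perL_of_nodes'' M T h07 h09a h09b ((N12a_iff T).mpr h.thetaSub) h12b ((N19w_iff T).mpr h.gen12)
    ((N19g_iff T).mpr h.real34) ((N29_iff T).mpr h.occ) ((N31_iff T).mpr h.chars) ((N33_iff T).mpr h.wedge)

/-- **THE HEADLINE**, bundled: `AssemblyRoutes.perL_of_openCharsWeilLeavesCRΔ`. -/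
theorem perL_of_headlineBundle (M : U.ModelAxioms) (T : U.ThetaModel) (h07 : N07_hodgeRiemann20 U)
    (h09a : N09a_embCover T) (h09b : N09b_innerEmb T) (hM38 : U.Fact_cmInflation) (h12b : N12b_signRecipe T)
    (Pc : ∀ {L : CMField} {ι₁ : L →+* ℂ} (V : HermSpace3 L ι₁) (c : SeesawCtx L),
      C4a.PointedCore (T.core V c))
    (h : HeadlineBundle T Pc) : U.PerL :=
  AssemblyRoutes.perL_of_openCharsWeilLeavesCRΔ M T h07 h09a h09b hM38 h.alb h12b h.bridges h.qaut Pc h.arch12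
    h.arch34 h.chars h.weil

/-! ## 3. Bundle ↔ dictionary leaves → node leaves -/

/-- **↓**: every record binder yields its dictionary leaf (`M`, `Fact_cmInflation` for S6; `hch` for S1). -/
theorem dictLeaves_of_headlineBundle (M : U.ModelAxioms) (hM38 : U.Fact_cmInflation)
    (Pc : ∀ {L : CMField} {ι₁ : L →+* ℂ} (V : HermSpace3 L ι₁) (c : SeesawCtx L),
      C4a.PointedCore (T.core V c))
    (h : HeadlineBundle T Pc) : DictLeaves T Pc where
  thetaSub := T.open_thetaSub_of_split M hM38 h.alb
  genIdentity := fun V c hc => (S5Conservative.bridges_iff_genIdentity T).1 h.bridges V c hc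
  core34 := fun V c hc => (S5ConservativeQaut.qautBridges_iff_core T).1 h.qaut V c hc
  charts12 := fun V c hc => (T.archC_binder_iff_core Pc (fun V c => T.t12 V c)).1 h.arch12 V c hc
  charts34 := fun V c hc => (T.archC_binder_iff_core Pc (fun V c => T.t34 V c)).1 h.arch34 V c hc
  chars := h.chars
  wedge := (thetaWedge_and_meet_of_CRΔ T h.chars h.weil).1
  meet := (thetaWedge_and_meet_of_CRΔ T h.chars h.weil).2

/-- **↑**: the dictionary leaves rebuild every record binder (`M`, N07, N09a, N09b, the `T`-free `SplitHolConfig`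
and `Fact_coverTheta` — all for the S1 binder; S4/S5/S6 are hypothesis-free). -/
theorem headlineBundle_of_dictLeaves (M : U.ModelAxioms) (hHR : U.Fact_hodgeRiemann20)
    (hE : T.Fact_embCover) (hI : T.Fact_innerEmb) (C : SplitHolConfig) (hcov : T.Fact_coverTheta)
    (Pc : ∀ {L : CMField} {ι₁ : L →+* ℂ} (V : HermSpace3 L ι₁) (c : SeesawCtx L),
      C4a.PointedCore (T.core V c))
    (h : DictLeaves T Pc) : HeadlineBundle T Pc where
  alb := T.thetaAlbanese_of_open h.thetaSub
  bridges := fun V c hc => (S5Conservative.bridges_iff_genIdentity T).2 h.genIdentity V c hc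
  qaut := fun V c hc => (S5ConservativeQaut.qautBridges_iff_core T).2 h.core34 V c hc
  arch12 := fun V c hc => (T.archC_binder_iff_core Pc (fun V c => T.t12 V c)).2 h.charts12 V c hc
  arch34 := fun V c hc => (T.archC_binder_iff_core Pc (fun V c => T.t34 V c)).2 h.charts34 V c hc
  chars := h.chars
  weil := (weilStepsInputCRΔ_iff_thetaWedge T M hHR hE hI h.thetaSub
    (open_thetaGen12_of_genIdentity T h.genIdentity h.chars) h.chars C hcov).2 ⟨h.wedge, h.meet⟩

/-- **EXACT STRENGTH of the headline's record bundle**: equivalent to the dictionary leaves, modulo the model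
axioms, the print leaves N07 N09a N09b, `Fact_cmInflation` (M38), the `T`-free `SplitHolConfig` and the
DEFINITIONAL `Fact_coverTheta`. -/
theorem headlineBundle_iff_dictLeaves (M : U.ModelAxioms) (hHR : U.Fact_hodgeRiemann20) (hE : T.Fact_embCover)
    (hI : T.Fact_innerEmb) (hM38 : U.Fact_cmInflation) (C : SplitHolConfig) (hcov : T.Fact_coverTheta)
    (Pc : ∀ {L : CMField} {ι₁ : L →+* ℂ} (V : HermSpace3 L ι₁) (c : SeesawCtx L),
      C4a.PointedCore (T.core V c)) :
    HeadlineBundle T Pc ↔ DictLeaves T Pc :=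
  ⟨dictLeaves_of_headlineBundle T M hM38 Pc, headlineBundle_of_dictLeaves T M hHR hE hI C hcov Pc⟩

/-- **Dictionary leaves ⇒ node leaves**, hypothesis-free (`OpenInputsN19`, `Open_occ_of_archC`). -/
theorem nodeLeaves_of_dictLeaves
    (Pc : ∀ {L : CMField} {ι₁ : L →+* ℂ} (V : HermSpace3 L ι₁) (c : SeesawCtx L),
      C4a.PointedCore (T.core V c))
    (h : DictLeaves T Pc) : NodeLeaves T where
  thetaSub := h.thetaSub
  gen12 := open_thetaGen12_of_genIdentity T h.genIdentity h.chars
  real34 := open_thetaReal34_of_core T h.core34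
  occ := T.Open_occ_of_archC Pc
    (fun V c hc => (T.archC_binder_iff_core Pc (fun V c => T.t12 V c)).2 h.charts12 V c hc)
    (fun V c hc => (T.archC_binder_iff_core Pc (fun V c => T.t34 V c)).2 h.charts34 V c hc)
  chars := h.chars
  wedge := h.wedge

/-- Hence headline bundle ⇒ node leaves (`M`, `Fact_cmInflation`). -/
theorem nodeLeaves_of_headlineBundle (M : U.ModelAxioms) (hM38 : U.Fact_cmInflation)
    (Pc : ∀ {L : CMField} {ι₁ : L →+* ℂ} (V : HermSpace3 L ι₁) (c : SeesawCtx L),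
      C4a.PointedCore (T.core V c))
    (h : HeadlineBundle T Pc) : NodeLeaves T :=
  nodeLeaves_of_dictLeaves T Pc (dictLeaves_of_headlineBundle T M hM38 Pc h)

/-- **The headline factors through the floor**: its PerL obtained via `perL_of_nodes''` from the node leaves of
its own bundle.  (Both sides are proofs of the `Prop` `U.PerL`; the content is that this term type-checks with the
headline's binders and nothing else.) -/
theorem perL_of_headlineBundle_via_nodes (M : U.ModelAxioms) (T : U.ThetaModel) (h07 : N07_hodgeRiemann20 U)
    (h09a : N09a_embCover T) (h09b : N09b_innerEmb T) (hM38 : U.Fact_cmInflation) (h12b : N12b_signRecipe T)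
    (Pc : ∀ {L : CMField} {ι₁ : L →+* ℂ} (V : HermSpace3 L ι₁) (c : SeesawCtx L),
      C4a.PointedCore (T.core V c))
    (h : HeadlineBundle T Pc) : U.PerL :=
  perL_of_nodeLeaves M T h07 h09a h09b h12b (nodeLeaves_of_headlineBundle T M hM38 Pc h)

/-- (Ported verbatim from the HodgeCMPerL package; no docstring in the source.) -/
theorem perL_of_headlineBundle_eq (M : U.ModelAxioms) (T : U.ThetaModel) (h07 : N07_hodgeRiemann20 U)
    (h09a : N09a_embCover T) (h09b : N09b_innerEmb T) (hM38 : U.Fact_cmInflation) (h12b : N12b_signRecipe T)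
    (Pc : ∀ {L : CMField} {ι₁ : L →+* ℂ} (V : HermSpace3 L ι₁) (c : SeesawCtx L),
      C4a.PointedCore (T.core V c))
    (h : HeadlineBundle T Pc) :
    perL_of_headlineBundle M T h07 h09a h09b hM38 h12b Pc h =
      perL_of_headlineBundle_via_nodes M T h07 h09a h09b hM38 h12b Pc h :=
  rfl

/-- **The dictionary leaves close PerL through the floor** (no `SplitHolConfig`, no `Fact_coverTheta`, no M38:
those are prices of REBUILDING the records, not of PerL). -/
theorem perL_of_dictLeaves (M : U.ModelAxioms) (T : U.ThetaModel) (h07 : N07_hodgeRiemann20 U)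
    (h09a : N09a_embCover T) (h09b : N09b_innerEmb T) (h12b : N12b_signRecipe T)
    (Pc : ∀ {L : CMField} {ι₁ : L →+* ℂ} (V : HermSpace3 L ι₁) (c : SeesawCtx L),
      C4a.PointedCore (T.core V c))
    (h : DictLeaves T Pc) : U.PerL :=
  perL_of_nodeLeaves M T h07 h09a h09b h12b (nodeLeaves_of_dictLeaves T Pc h)

/-- The `Pc` binder is always available (Hahn–Banach points, `ThetaModel.pointedCores`), so the records may be
read at `Pc := T.pointedCores`. -/
theorem perL_of_headlineBundle_pointed (M : U.ModelAxioms) (T : U.ThetaModel) (h07 : N07_hodgeRiemann20 U)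
    (h09a : N09a_embCover T) (h09b : N09b_innerEmb T) (hM38 : U.Fact_cmInflation) (h12b : N12b_signRecipe T)
    (h : HeadlineBundle T (fun V c => T.pointedCores V c)) : U.PerL :=
  perL_of_headlineBundle M T h07 h09a h09b hM38 h12b _ h

end EndStateCensus
end PerL34
end HodgeCM

end
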